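import Summits.MatrixMultiplication.MatrixMultiplication.Theorems.GradedDesignFamily.Negative.SubfieldCellTwentyfiveEmbedding
import Summits.MatrixMultiplication.MatrixMultiplication.Theorems.GradedDesignFamily.Negative.SubfieldCellTwentyfiveWallSharp

/-!
# Subfield cell `GL₂(𝔽₂₅) ⊃ SL₂(𝔽₅)` at level one — the exact wall `|Y| + |Z| ≤ 104` for EVERY `(k, K, φ)` with `|k| = 5`

**Honest framing.** VALUE = a kernel-checked bound for ONE finite cell (`|k| = 5`, `|K| = 25`) of
ONE skeleton line (`quadratic_extension_level_one_cell`, stub S3 `stub_subfieldCell`, crux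
`GradedDesignFamily`, route `LevelGradedCohnUmans`, stmt-MatrixMultiplication-7610).  It is **not**
summit progress (no bound on `ω`) and does **not** bear on the asymptotic stub
(`∃ c > 0, ∀ N, ∃ (k, K, φ) …` is insensitive to any single cell).

## The theorems

* `isSep_transport`: any level-one separated triple `(φ(SL₂ k), Y, Z)` in `GL₂(K')` with `|k| = 5`,
  `|K'| = 25`, `φ` injective, yields one in the standard model (`k = 𝔽₅ = ZMod 5`,
  `K = 𝔽₂₅ = QuadraticAlgebra (ZMod 5) 2 0`, `φ = mapGL`) with the same `|Y|, |Z|` — via `k ≅ 𝔽₅`, `K' ≅ 𝔽₂₅`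
  (`FiniteField.ringEquivOfCardEq`) and `embedding_conj` (file `SubfieldCellTwentyfiveEmbedding`:
  the transported embedding is `g · mapGL ∘ τ · g⁻¹` with `τ` a bijective endomorphism of `SL₂(𝔽₅)`
  (in fact `τ = id`), absorbed by reindexing `a ↦ τ a`).
* `subfieldCell_twentyfive_wall_sharp_any`: for all `(k, K', φ)` with `|k| = 5`, `|K'| = |k|²`,
  `φ : SL₂(k) ↪ GL₂(K')`, and nonempty `Y, Z` satisfying S3's clause verbatim: `|Y| + |Z| ≤ 104`
  (hence `|Y|·|Z| ≤ 2704`, `subfieldCell_twentyfive_area_le_any`), by `subfieldCell_twentyfive_wall_sharp`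
  (files `SubfieldCellTwentyfiveWallSharp{Data,Rel0–Rel4,}`, gen 14).  This is the counting wall of SUBFIELD.md §2 as a
  theorem about S3's clause itself; it improves the relation-free `subfieldCell_twentyfive_wall` (`≤ 105`,
  `SubfieldCellTwentyfiveCubes`) by one and is SHARP (`subfieldCell_twentyfive_witnessN`, `(1, 103)`).

Gen 14, unit b2b-lgcu-subfield-g14.  No new computation in this file.
-/

set_option linter.dupNamespace false
set_option linter.style.longLine false

namespace Summit.MatrixMultiplication.MatrixMultiplication.Theorems.GradedDesignFamily.Negative.SubfieldTwentyfive

open Matrix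

/-- Column vectors `𝔽₂₅²`. -/
abbrev Vec : Type := Fin 2 → K25

/-- Level-one separation in the standard model `(mapGL(SL₂ 𝔽₅), Y, Z)`, S3's clause verbatim. -/
def IsSep (Y Z : Finset (GL (Fin 2) K25)) : Prop :=
  ∀ z₀ ∈ Z, ∃ cf : (Fin 2 → K25) → (Fin 2 → K25) → ℂ,
    ∀ a : SL5, ∀ y ∈ Y, ∀ y' ∈ Y, ∀ z ∈ Z,
      (∑ u : Fin 2 → K25, cf u (((Matrix.SpecialLinearGroup.mapGL K25 a * y * y'⁻¹ * z : GL (Fin 2) K25) :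
          Matrix (Fin 2) (Fin 2) K25).mulVec u)) =
        if a = 1 ∧ y = y' ∧ z = z₀ then 1 else 0

/-- **Transport to the standard model.** Any level-one separated triple `(φ(SL₂ k), Y, Z)` in
`GL₂(K')`, `|k| = 5`, `|K'| = 25`, yields one in the standard model with the same `|Y|, |Z|`. -/
theorem isSep_transport {k K' : Type} [Field k] [Fintype k] [DecidableEq k] [Field K']
    [Fintype K'] [DecidableEq K'] (hk : Fintype.card k = 5)
    (φ : Matrix.SpecialLinearGroup (Fin 2) k →* Matrix.GeneralLinearGroup (Fin 2) K')
    (hφ : Function.Injective φ) (hK : Fintype.card K' = Fintype.card k ^ 2)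
    (Y Z : Finset (Matrix.GeneralLinearGroup (Fin 2) K'))
    (hsep : ∀ z₀ ∈ Z, ∃ cf : (Fin 2 → K') → (Fin 2 → K') → ℂ,
      ∀ a : Matrix.SpecialLinearGroup (Fin 2) k, ∀ y ∈ Y, ∀ y' ∈ Y, ∀ z ∈ Z,
        (∑ u : Fin 2 → K', cf u (((φ a * y * y'⁻¹ * z : Matrix.GeneralLinearGroup (Fin 2) K') :
            Matrix (Fin 2) (Fin 2) K').mulVec u)) =
          if a = 1 ∧ y = y' ∧ z = z₀ then 1 else 0) :
    ∃ Y' Z' : Finset (GL (Fin 2) K25), Y'.card = Y.card ∧ Z'.card = Z.card ∧ IsSep Y' Z' := by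
  -- `k ≅ 𝔽₅`
  have hk5 : Fintype.card K5 = Fintype.card k := by rw [card_K5, hk]
  let ι : K5 ≃+* k := FiniteField.ringEquivOfCardEq hk5
  let F : SL5 →* Matrix.SpecialLinearGroup (Fin 2) k := Matrix.SpecialLinearGroup.map ι.toRingHom
  have hFcoe : ∀ a : SL5, ∀ i j,
      (F a : Matrix (Fin 2) (Fin 2) k) i j = ι ((a : Matrix (Fin 2) (Fin 2) K5) i j) := by
    intro a i j; rfl
  have hFinj : Function.Injective F := by
    intro a b hab
    apply Matrix.SpecialLinearGroup.ext
    intro i j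
    have h := congrArg (fun m : Matrix.SpecialLinearGroup (Fin 2) k =>
      (m : Matrix (Fin 2) (Fin 2) k) i j) hab
    simp only [hFcoe] at h
    exact ι.injective h
  -- `K' ≅ 𝔽₂₅`
  have hK25 : Fintype.card K' = Fintype.card K25 := by rw [hK, hk, card_K25]; norm_num
  let ψ : K' ≃+* K25 := FiniteField.ringEquivOfCardEq hK25
  let Ψ : GL (Fin 2) K' →* GL (Fin 2) K25 := Matrix.GeneralLinearGroup.map ψ.toRingHom
  have hΨcoe : ∀ g : GL (Fin 2) K', ∀ i j,
      ((Ψ g : GL (Fin 2) K25) : Mat) i j = ψ ((g : Matrix (Fin 2) (Fin 2) K') i j) := by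
    intro g i j
    exact Matrix.GeneralLinearGroup.map_apply _ i j g
  have hΨinj : Function.Injective Ψ := by
    intro a b hab
    apply Units.ext
    ext i j
    have h := congrArg (fun m : GL (Fin 2) K25 => (m : Mat) i j) hab
    simp only [hΨcoe] at h
    exact ψ.injective h
  -- the transported embedding is `G · mapGL ∘ τ · G⁻¹`
  let φ' : SL5 →* GL (Fin 2) K25 := Ψ.comp (φ.comp F)
  have hφ' : Function.Injective φ' := hΨinj.comp (hφ.comp hFinj)
  obtain ⟨G, τ, hτ, hG⟩ := embedding_conj φ' hφ'
  -- the transported sets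
  let fY : GL (Fin 2) K' → GL (Fin 2) K25 := fun y => G⁻¹ * Ψ y
  let fZ : GL (Fin 2) K' → GL (Fin 2) K25 := fun z => G⁻¹ * Ψ z * G
  have hfY : Function.Injective fY := fun a b h => hΨinj (mul_left_cancel h)
  have hfZ : Function.Injective fZ := fun a b h => hΨinj (mul_left_cancel (mul_right_cancel h))
  refine ⟨Y.image fY, Z.image fZ, Finset.card_image_of_injective _ hfY,
    Finset.card_image_of_injective _ hfZ, ?_⟩
  intro z₀' hz₀'
  obtain ⟨z₀, hz₀, rfl⟩ := Finset.mem_image.1 hz₀'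
  obtain ⟨cf, hcf⟩ := hsep z₀ hz₀
  -- the change of frames `θ u = ψ⁻¹ (G u)`
  let θ : Vec → (Fin 2 → K') := fun u i => ψ.symm (((G : Mat) *ᵥ u) i)
  refine ⟨fun u v => cf (θ u) (θ v), ?_⟩
  intro a₀ y₁' hy₁' y₂' hy₂' z' hz'
  obtain ⟨y₁, hy₁, rfl⟩ := Finset.mem_image.1 hy₁'
  obtain ⟨y₂, hy₂, rfl⟩ := Finset.mem_image.1 hy₂'
  obtain ⟨z, hz, rfl⟩ := Finset.mem_image.1 hz'
  obtain ⟨a, rfl⟩ := hτ.2 a₀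
  set M : GL (Fin 2) K' := φ (F a) * y₁ * y₂⁻¹ * z with hM
  have hprod : Matrix.SpecialLinearGroup.mapGL K25 (τ a) * fY y₁ * (fY y₂)⁻¹ * fZ z = G⁻¹ * Ψ M * G := by
    have h1 : Matrix.SpecialLinearGroup.mapGL K25 (τ a) = G⁻¹ * φ' a * G := by rw [hG a]; group
    have h2 : φ' a = Ψ (φ (F a)) := rfl
    rw [h1, h2, hM, map_mul, map_mul, map_mul, map_inv]
    simp only [fY, fZ]
    group
  rw [hprod]
  -- the summand, rewritten
  have hsummand : ∀ u : Vec,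
      θ (((G⁻¹ * Ψ M * G : GL (Fin 2) K25) : Mat) *ᵥ u) = (M : Matrix (Fin 2) (Fin 2) K') *ᵥ θ u := by
    intro u
    have e1 : (G : Mat) *ᵥ (((G⁻¹ * Ψ M * G : GL (Fin 2) K25) : Mat) *ᵥ u) =
        ((Ψ M : GL (Fin 2) K25) : Mat) *ᵥ ((G : Mat) *ᵥ u) := by
      rw [Units.val_mul, Units.val_mul, Matrix.mulVec_mulVec, ← _root_.mul_assoc, ← _root_.mul_assoc,
        Units.mul_inv, _root_.one_mul, ← Matrix.mulVec_mulVec]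
    funext i
    simp only [θ]
    rw [e1]
    generalize (G : Mat) *ᵥ u = w
    have hMw : ∀ i, (((Ψ M : GL (Fin 2) K25) : Mat) *ᵥ w) i =
        ∑ j, ψ ((M : Matrix (Fin 2) (Fin 2) K') i j) * w j := by
      intro i
      simp only [Matrix.mulVec, dotProduct, hΨcoe]
    rw [hMw]
    simp only [Matrix.mulVec, dotProduct, map_sum, map_mul, RingEquiv.symm_apply_apply]
  simp only [hsummand]
  -- reindex the frame sum along the bijection `θ`
  let eG : Vec ≃ Vec :=
    { toFun := fun u => (G : Mat) *ᵥ u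
      invFun := fun u => ((G⁻¹ : GL (Fin 2) K25) : Mat) *ᵥ u
      left_inv := fun u => by
        simp only [Matrix.mulVec_mulVec, Units.inv_mul, Matrix.one_mulVec]
      right_inv := fun u => by
        simp only [Matrix.mulVec_mulVec, Units.mul_inv, Matrix.one_mulVec] }
  let e : Vec ≃ (Fin 2 → K') := eG.trans (Equiv.piCongrRight fun _ : Fin 2 => ψ.symm.toEquiv)
  have he : ∀ u, e u = θ u := fun u => rfl
  simp only [← he]
  rw [Equiv.sum_comp e (fun v => cf v ((M : Matrix (Fin 2) (Fin 2) K') *ᵥ v)), hM,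
    hcf (F a) y₁ hy₁ y₂ hy₂ z hz]
  refine if_congr ?_ rfl rfl
  rw [map_eq_one_iff F hFinj, map_eq_one_iff τ hτ.1, hfY.eq_iff, hfZ.eq_iff]

/-- **The exact wall of the `|k| = 5` subfield cell, in full generality:** for all fields `k, K'`
with `|k| = 5`, `|K'| = |k|²`, every injective `φ : SL₂(k) →* GL₂(K')` and all non-empty finite
`Y, Z ⊆ GL₂(K')` satisfying the separation clause of S3 verbatim: `|Y| + |Z| ≤ 104`.  Sharp
(`subfieldCell_twentyfive_witnessN`, `(1, 103)`).  Finite-cell verdict, not summit progress. -/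
theorem subfieldCell_twentyfive_wall_sharp_any {k K' : Type} [Field k] [Fintype k] [DecidableEq k]
    [Field K'] [Fintype K'] [DecidableEq K'] (hk : Fintype.card k = 5)
    (φ : Matrix.SpecialLinearGroup (Fin 2) k →* Matrix.GeneralLinearGroup (Fin 2) K')
    (hφ : Function.Injective φ) (hK : Fintype.card K' = Fintype.card k ^ 2)
    (Y Z : Finset (Matrix.GeneralLinearGroup (Fin 2) K')) (hY : Y.Nonempty) (hZ : Z.Nonempty)
    (hsep : ∀ z₀ ∈ Z, ∃ cf : (Fin 2 → K') → (Fin 2 → K') → ℂ,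
      ∀ a : Matrix.SpecialLinearGroup (Fin 2) k, ∀ y ∈ Y, ∀ y' ∈ Y, ∀ z ∈ Z,
        (∑ u : Fin 2 → K', cf u (((φ a * y * y'⁻¹ * z : Matrix.GeneralLinearGroup (Fin 2) K') :
            Matrix (Fin 2) (Fin 2) K').mulVec u)) =
          if a = 1 ∧ y = y' ∧ z = z₀ then 1 else 0) :
    Y.card + Z.card ≤ 104 := by
  obtain ⟨Y', Z', hYc, hZc, hsep'⟩ := isSep_transport hk φ hφ hK Y Z hsep
  have hY' : Y'.Nonempty := by
    rw [← Finset.card_pos, hYc]; exact hY.card_pos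
  have hZ' : Z'.Nonempty := by
    rw [← Finset.card_pos, hZc]; exact hZ.card_pos
  have wall := subfieldCell_twentyfive_wall_sharp Y' Z' hY' hZ' hsep'
  omega

/-- Corollary: `|Y|·|Z| ≤ 2704` for every such `(k, K', φ, Y, Z)` (AM–GM on `|Y| + |Z| ≤ 104`). -/
theorem subfieldCell_twentyfive_area_le_any {k K' : Type} [Field k] [Fintype k] [DecidableEq k]
    [Field K'] [Fintype K'] [DecidableEq K'] (hk : Fintype.card k = 5)
    (φ : Matrix.SpecialLinearGroup (Fin 2) k →* Matrix.GeneralLinearGroup (Fin 2) K')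
    (hφ : Function.Injective φ) (hK : Fintype.card K' = Fintype.card k ^ 2)
    (Y Z : Finset (Matrix.GeneralLinearGroup (Fin 2) K')) (hY : Y.Nonempty) (hZ : Z.Nonempty)
    (hsep : ∀ z₀ ∈ Z, ∃ cf : (Fin 2 → K') → (Fin 2 → K') → ℂ,
      ∀ a : Matrix.SpecialLinearGroup (Fin 2) k, ∀ y ∈ Y, ∀ y' ∈ Y, ∀ z ∈ Z,
        (∑ u : Fin 2 → K', cf u (((φ a * y * y'⁻¹ * z : Matrix.GeneralLinearGroup (Fin 2) K') :
            Matrix (Fin 2) (Fin 2) K').mulVec u)) =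
          if a = 1 ∧ y = y' ∧ z = z₀ then 1 else 0) :
    Y.card * Z.card ≤ 2704 := by
  have h := subfieldCell_twentyfive_wall_sharp_any hk φ hφ hK Y Z hY hZ hsep
  nlinarith [Nat.mul_le_mul h h, sq_nonneg ((Y.card : ℤ) - Z.card)]

end Summit.MatrixMultiplication.MatrixMultiplication.Theorems.GradedDesignFamily.Negative.SubfieldTwentyfive
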